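import Mathlib.RingTheory.Henselian
import Mathlib.Algebra.Polynomial.UnitTrinomial
import Mathlib.LinearAlgebra.Matrix.GeneralLinearGroup.Defs
import Mathlib.LinearAlgebra.Matrix.Notation
import Mathlib.RingTheory.LocalRing.ResidueField.Basic
import Mathlib.RingTheory.LocalRing.RingHom.Basic
import Mathlib.Tactic.LinearCombination
import Mathlib.Tactic.Group
import Literature.NumberTheory.GaloisRepresentations.NearlyOrdinaryDeformationRing
import HarnessLib

/-!
# Hensel eigenframes: the special line of a `p`-distinguished nearly ordinary lift is unique

Topic `Literature/NumberTheory/GaloisRepresentations`.  First step of the construction behind the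
named fact `nearlyOrdinaryDeformationRing_nonempty` (`NearlyOrdinaryDeformationRing.lean`;
Calegari–Mazur, *Nearly ordinary Galois deformations over arbitrary number fields*, §2.2, citing
Mazur §30): the existential condition "nearly ordinary at `v` with the prescribed residual special
line" (`NearlyOrdinaryDatum.IsNearlyOrdinaryAt`, [CM, Def. 2.2]) becomes a CLOSED, functorial
condition once `ρ̄|_{D_v}` is `v`-distinguished ([CM, Def. 2.3]: "If `ρ` is distinguished at `v`
there are at most two `D_v`-stable lines to choose as our special `L_{A,v}`, and if, in addition,
`V_A` is indecomposable as `D_v`-representation, there is only one such choice").  Concretely, for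
a local ring `A` Henselian at `𝔪_A` (e.g. complete) with residue map `π : A → k` onto a field:

* `Deformation.IsCharRoot M δ`, `Deformation.exists_isCharRoot`, `IsCharRoot.unique`,
  `IsCharRoot.map_eq` — for `M ∈ M₂(A)` residually upper triangular with distinct diagonal
  residues, the characteristic polynomial has a unique root `δ` lifting the lower residual
  eigenvalue (Hensel), functorial under local homomorphisms;
* `Deformation.eigenFrame M δ`, `eigenFrameGL` — the frame `C = ((M-δ)e₁ | (M-α)e₂)`,
  `α = tr M - δ`, invertible, with `C⁻¹ M C = diag(α, δ)` (`eigenFrameGL_inv_mul_mul`);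
* `Deformation.eigenFrameGL_inv_mul_lowerLeft_eq_zero` — **uniqueness of the special line**:
  any frame `P` with `π P₁₀ = 0` whose first column spans an `M`-stable line satisfies
  `(C⁻¹ P)₁₀ = 0`;
* `Deformation.exists_frame_iff_eigenFrameGL` — a family of matrices containing `M` is
  simultaneously upper-triangularisable by such a `P` iff it is upper triangular in the frame `C`;
* `Deformation.exists_generalLinearGroup_map_eq` — frames over `k` lift to `GL_n(A)`;
* `NearlyOrdinaryDatum.isNearlyOrdinaryAt_iff_eigenFrameGL` — for a lift `ρ` of `ρ̄`
  (`GL₂(π) ∘ ρ = ρ̄`), a place `v ∣ p` at which `ρ̄` is distinguished (witness `σ₀`), a lift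
  `Fv ∈ GL₂(A)` of the residual frame and the Hensel root `δ` of `Fv⁻¹ ρ(σ₀) Fv`:
  `𝒟.IsNearlyOrdinaryAt π ρ v ↔ ∀ σ, ((Fv C)⁻¹ ρ(σ) (Fv C))₁₀ = 0`.

Nothing here is a named fact; all statements are proved.

## References

* [CM] F. Calegari, B. Mazur, *Nearly ordinary Galois deformations over arbitrary number fields*,
  J. Inst. Math. Jussieu 8 (2009) 99–177, §2.1 Def. 2.1–2.3 and the Remark following Def. 2.3
  (arXiv:0708.2451, p. 7). [cite: CalegariMazur2008, Def. 2.2–2.3]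
* [Maz] B. Mazur, *An introduction to the deformation theory of Galois representations*, in
  Modular Forms and Fermat's Last Theorem (Springer 1997), §30 (the condition of being ordinary).
  [cite: Mazur1997Deformation, §30]
-/

noncomputable section

open Polynomial IsLocalRing Matrix IsDedekindDomain Field
open scoped NumberField

namespace Literature.NumberTheory.GaloisRepresentations

namespace Deformation

section Residue

variable {A : Type*} [CommRing A] [IsLocalRing A] {k : Type*} [Field k] {π : A →+* k}

/-- In a local ring with residue map `π` onto a field, `x ∈ 𝔪 ↔ π x = 0`. [folklore] -/
theorem mem_maximalIdeal_iff_residue_eq_zero (hπ : Function.Surjective π) {x : A} :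
    x ∈ maximalIdeal A ↔ π x = 0 := by
  rw [← IsLocalRing.ker_eq_maximalIdeal π hπ, RingHom.mem_ker]

/-- In a local ring with residue map `π` onto a field, `x` is a unit iff `π x ≠ 0`. [folklore] -/
theorem isUnit_iff_residue_ne_zero (hπ : Function.Surjective π) {x : A} :
    IsUnit x ↔ π x ≠ 0 := by
  rw [Ne, ← mem_maximalIdeal_iff_residue_eq_zero hπ, IsLocalRing.mem_maximalIdeal, mem_nonunits_iff,
    not_not]

end Residue

section EigenFrame

variable {A : Type*} [CommRing A]

/-- The **eigenframe** of a `2 × 2` matrix `M` attached to a root `δ` of its characteristic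
polynomial: its columns are `(M - δ) e₁` (an eigenvector for the other root `α = tr M - δ`) and
`(M - α) e₂` (an eigenvector for `δ`).  For `M = ρ(σ)` residually upper triangular with distinct
diagonal entries and `δ` the Hensel lift of the lower one, this is a basis adapted to the
decomposition `V_A = L_A ⊕ L̃_A` into the special line and a complement.
[cite: CalegariMazur2008, Def. 2.1–2.3] -/
def eigenFrame (M : Matrix (Fin 2) (Fin 2) A) (δ : A) : Matrix (Fin 2) (Fin 2) A :=
  !![M 0 0 - δ, M 0 1; M 1 0, δ - M 0 0]

/-- Entry `(0,0)` of the eigenframe. [folklore] -/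
@[simp] theorem eigenFrame_apply_00 (M : Matrix (Fin 2) (Fin 2) A) (δ : A) :
    eigenFrame M δ 0 0 = M 0 0 - δ := rfl
/-- Entry `(0,1)` of the eigenframe. [folklore] -/
@[simp] theorem eigenFrame_apply_01 (M : Matrix (Fin 2) (Fin 2) A) (δ : A) :
    eigenFrame M δ 0 1 = M 0 1 := rfl
/-- Entry `(1,0)` of the eigenframe. [folklore] -/
@[simp] theorem eigenFrame_apply_10 (M : Matrix (Fin 2) (Fin 2) A) (δ : A) :
    eigenFrame M δ 1 0 = M 1 0 := rfl
/-- Entry `(1,1)` of the eigenframe. [folklore] -/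
@[simp] theorem eigenFrame_apply_11 (M : Matrix (Fin 2) (Fin 2) A) (δ : A) :
    eigenFrame M δ 1 1 = δ - M 0 0 := rfl

/-- `det (eigenFrame M δ) = -((M₀₀ - δ)² + M₀₁ M₁₀)`. [folklore] -/
theorem det_eigenFrame (M : Matrix (Fin 2) (Fin 2) A) (δ : A) :
    (eigenFrame M δ).det = -((M 0 0 - δ) ^ 2 + M 0 1 * M 1 0) := by
  rw [det_fin_two]
  simp only [eigenFrame_apply_00, eigenFrame_apply_11, eigenFrame_apply_01, eigenFrame_apply_10]
  ring

/-- `δ` is a root of the characteristic polynomial `X² - tr M · X + det M` of the `2 × 2` matrix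
`M`, written as `α δ = det M` with `α = tr M - δ`. [folklore] -/
def IsCharRoot (M : Matrix (Fin 2) (Fin 2) A) (δ : A) : Prop :=
  (M 0 0 + M 1 1 - δ) * δ = M 0 0 * M 1 1 - M 0 1 * M 1 0

/-- **Diagonalisation in the eigenframe**: if `δ` is a root of the characteristic polynomial of
`M`, then `M · C = C · diag(α, δ)` for the eigenframe `C` and `α = tr M - δ`. [folklore] -/
theorem mul_eigenFrame {M : Matrix (Fin 2) (Fin 2) A} {δ : A} (h : IsCharRoot M δ) :
    M * eigenFrame M δ = eigenFrame M δ * Matrix.diagonal ![M 0 0 + M 1 1 - δ, δ] := by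
  unfold IsCharRoot at h
  ext i j
  fin_cases i <;> fin_cases j <;>
    simp [Matrix.mul_apply, Fin.sum_univ_two, Matrix.diagonal] <;>
    first | ring1 | linear_combination h

/-- The root of the characteristic polynomial is **functorial** under ring homomorphisms.
[folklore] -/
theorem IsCharRoot.map {B : Type*} [CommRing B] {M : Matrix (Fin 2) (Fin 2) A} {δ : A}
    (h : IsCharRoot M δ) (φ : A →+* B) : IsCharRoot (M.map φ) (φ δ) := by
  unfold IsCharRoot at h ⊢
  simp only [Matrix.map_apply]
  have := congrArg φ h
  simpa only [map_mul, map_sub, map_add] using this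

/-- The eigenframe is functorial under ring homomorphisms. [folklore] -/
theorem eigenFrame_map {B : Type*} [CommRing B] (M : Matrix (Fin 2) (Fin 2) A) (δ : A)
    (φ : A →+* B) : (eigenFrame M δ).map φ = eigenFrame (M.map φ) (φ δ) := by
  ext i j
  fin_cases i <;> fin_cases j <;> simp [eigenFrame, map_sub]

/-- The inverse of an invertible upper-triangular `2 × 2` matrix is upper triangular. [folklore] -/
theorem inv_lowerLeft_eq_zero {Q : GL (Fin 2) A} (hQ : Q.val 1 0 = 0) : (Q⁻¹).val 1 0 = 0 := by
  have hinv : (Q⁻¹).val * Q.val = 1 := by rw [← Units.val_mul, inv_mul_cancel, Units.val_one]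
  have hdetQ : IsUnit Q.val.det := Matrix.isUnits_det_units Q
  rw [det_fin_two, hQ, mul_zero, sub_zero] at hdetQ
  have hQ00 : IsUnit (Q.val 0 0) := isUnit_of_mul_isUnit_left hdetQ
  have := congrFun (congrFun hinv 1) 0
  rw [Matrix.mul_apply, Fin.sum_univ_two, hQ, mul_zero, add_zero, Matrix.one_apply_ne (by decide)]
    at this
  exact (hQ00.mul_left_eq_zero).1 this

/-- Conjugating by an invertible upper-triangular matrix does not change whether the lower-left
entry vanishes. [folklore] -/
theorem lowerLeft_conj_eq_zero_iff_of_upper {Q : GL (Fin 2) A} (hQ : Q.val 1 0 = 0)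
    (X : Matrix (Fin 2) (Fin 2) A) :
    ((Q⁻¹).val * X * Q.val) 1 0 = 0 ↔ X 1 0 = 0 := by
  have hdetQ : IsUnit Q.val.det := Matrix.isUnits_det_units Q
  rw [det_fin_two, hQ, mul_zero, sub_zero] at hdetQ
  have hQ00 : IsUnit (Q.val 0 0) := isUnit_of_mul_isUnit_left hdetQ
  have h10 : (Q⁻¹).val 1 0 = 0 := inv_lowerLeft_eq_zero hQ
  have hdetQi : IsUnit (Q⁻¹).val.det := Matrix.isUnits_det_units Q⁻¹
  rw [det_fin_two, h10, mul_zero, sub_zero] at hdetQi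
  have hQi11 : IsUnit ((Q⁻¹).val 1 1) := isUnit_of_mul_isUnit_right hdetQi
  have hentry : ((Q⁻¹).val * X * Q.val) 1 0 = (Q⁻¹).val 1 1 * X 1 0 * Q.val 0 0 := by
    simp only [Matrix.mul_apply, Fin.sum_univ_two, h10, hQ, zero_mul, zero_add, mul_zero, add_zero]
  rw [hentry]
  constructor
  · intro h
    have h' : (Q⁻¹).val 1 1 * X 1 0 = 0 := (hQ00.mul_left_eq_zero).1 h
    exact (hQi11.mul_right_eq_zero).1 h'
  · intro h
    rw [h, mul_zero, zero_mul]

end EigenFrame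

section Hensel

variable {A : Type*} [CommRing A] [IsLocalRing A] {k : Type*} [Field k] {π : A →+* k}

/-- **Hensel lift of the lower residual eigenvalue.**  Let `A` be a local ring, Henselian (e.g.
complete), with residue map `π` onto `k`, and `M ∈ M₂(A)` residually upper triangular with distinct
diagonal entries `π M₀₀ ≠ π M₁₁`.  Then the characteristic polynomial of `M` has a root `δ ∈ A`
lifting `π M₁₁`. [cite: CalegariMazur2008, Def. 2.3] -/
theorem exists_isCharRoot [HenselianRing A (maximalIdeal A)] (hπ : Function.Surjective π)
    (M : Matrix (Fin 2) (Fin 2) A) (h10 : π (M 1 0) = 0) (hne : π (M 0 0) ≠ π (M 1 1)) :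
    ∃ δ : A, π δ = π (M 1 1) ∧ IsCharRoot M δ := by
  let f : A[X] := trinomial 0 1 2 (M 0 0 * M 1 1 - M 0 1 * M 1 0) (-(M 0 0 + M 1 1)) 1
  have hf : f.Monic := trinomial_monic zero_lt_one one_lt_two
  have heval : ∀ a : A, f.eval a =
      a * a - (M 0 0 + M 1 1) * a + (M 0 0 * M 1 1 - M 0 1 * M 1 0) := by
    intro a
    simp only [f, trinomial, eval_add, eval_mul, eval_C, eval_pow, eval_X]
    ring
  have hderiv : ∀ a : A, f.derivative.eval a = 2 * a - (M 0 0 + M 1 1) := by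
    intro a
    simp only [f, trinomial, derivative_add, derivative_C_mul_X_pow, eval_add, eval_mul, eval_C,
      eval_pow, eval_X]
    push_cast
    ring
  have hval : f.eval (M 1 1) ∈ maximalIdeal A := by
    rw [heval, mem_maximalIdeal_iff_residue_eq_zero hπ]
    simp only [map_add, map_sub, map_mul, h10]
    ring
  have hder : IsUnit (Ideal.Quotient.mk (maximalIdeal A) (f.derivative.eval (M 1 1))) := by
    refine IsUnit.map _ ?_
    rw [hderiv, isUnit_iff_residue_ne_zero hπ]
    simp only [map_sub, map_mul, map_add, map_ofNat]
    intro h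
    apply hne
    linear_combination (-1 : k) * h
  obtain ⟨δ, hroot, hδ⟩ := HenselianRing.is_henselian (I := maximalIdeal A) f hf (M 1 1) hval hder
  refine ⟨δ, ?_, ?_⟩
  · have : π (δ - M 1 1) = 0 := (mem_maximalIdeal_iff_residue_eq_zero hπ).1 hδ
    rwa [map_sub, sub_eq_zero] at this
  · have h0 : f.eval δ = 0 := hroot
    rw [heval] at h0
    unfold IsCharRoot
    linear_combination (-1 : A) * h0

/-- **Uniqueness of the Hensel lift**: a root of the characteristic polynomial lifting `π M₁₁` is
unique (the two residual roots being distinct). [cite: CalegariMazur2008, Def. 2.3] -/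
theorem IsCharRoot.unique (hπ : Function.Surjective π) {M : Matrix (Fin 2) (Fin 2) A}
    (hne : π (M 0 0) ≠ π (M 1 1)) {δ δ' : A} (h : IsCharRoot M δ) (h' : IsCharRoot M δ')
    (hδ : π δ = π (M 1 1)) (hδ' : π δ' = π (M 1 1)) : δ = δ' := by
  let f : A[X] := trinomial 0 1 2 (M 0 0 * M 1 1 - M 0 1 * M 1 0) (-(M 0 0 + M 1 1)) 1
  have heval : ∀ a : A, f.eval a =
      a * a - (M 0 0 + M 1 1) * a + (M 0 0 * M 1 1 - M 0 1 * M 1 0) := by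
    intro a
    simp only [f, trinomial, eval_add, eval_mul, eval_C, eval_pow, eval_X]
    ring
  have hderiv : ∀ a : A, f.derivative.eval a = 2 * a - (M 0 0 + M 1 1) := by
    intro a
    simp only [f, trinomial, derivative_add, derivative_C_mul_X_pow, eval_add, eval_mul, eval_C,
      eval_pow, eval_X]
    push_cast
    ring
  unfold IsCharRoot at h h'
  refine IsLocalRing.eq_of_eval_eq_zero_of_not_isUnit_sub (f := f) ?_ ?_ ?_ ?_
  · rw [heval]; linear_combination (-1 : A) * h
  · rw [heval]; linear_combination (-1 : A) * h'
  · rw [isUnit_iff_residue_ne_zero hπ, not_not, map_sub, hδ, hδ', sub_self]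
  · rw [hderiv, isUnit_iff_residue_ne_zero hπ]
    simp only [map_sub, map_mul, map_add, map_ofNat, hδ]
    intro h0
    apply hne
    linear_combination (-1 : k) * h0

omit [IsLocalRing A] in
/-- The Hensel root is **functorial**: a ring homomorphism `φ : A → B` of local rings compatible
with residue maps `π_B ∘ φ = π_A` onto the common residue field carries the root lifting `π M₁₁`
to the root lifting `π_B (φ M)₁₁`. [folklore] -/
theorem IsCharRoot.map_eq {B : Type*} [CommRing B] [IsLocalRing B] {πB : B →+* k}
    (hπB : Function.Surjective πB) (φ : A →+* B) (hφ : πB.comp φ = π)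
    {M : Matrix (Fin 2) (Fin 2) A} (hne : π (M 0 0) ≠ π (M 1 1)) {δ : A} (h : IsCharRoot M δ)
    (hδ : π δ = π (M 1 1)) {δB : B} (hB : IsCharRoot (M.map φ) δB)
    (hδB : πB δB = πB ((M.map φ) 1 1)) : φ δ = δB := by
  have hc : ∀ a : A, πB (φ a) = π a := fun a => by rw [← hφ]; rfl
  refine IsCharRoot.unique hπB (M := M.map φ) ?_ (h.map φ) hB ?_ hδB
  · simpa only [Matrix.map_apply, hc] using hne
  · simp only [Matrix.map_apply, hc, hδ]

end Hensel

section SpecialLine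

variable {A : Type*} [CommRing A] [IsLocalRing A] {k : Type*} [Field k] {π : A →+* k}

/-- The eigenframe of a residually distinguished, residually upper-triangular `M` is invertible:
its determinant reduces to `-(ā - d̄)² ≠ 0`. [cite: CalegariMazur2008, Def. 2.3] -/
theorem isUnit_det_eigenFrame (hπ : Function.Surjective π) {M : Matrix (Fin 2) (Fin 2) A}
    {δ : A} (h10 : π (M 1 0) = 0) (hne : π (M 0 0) ≠ π (M 1 1)) (hδ : π δ = π (M 1 1)) :
    IsUnit (eigenFrame M δ).det := by
  rw [isUnit_iff_residue_ne_zero hπ, det_eigenFrame]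
  simp only [map_neg, map_add, map_pow, map_mul, map_sub, h10, hδ, mul_zero, add_zero]
  exact neg_ne_zero.2 (pow_ne_zero 2 (sub_ne_zero.2 hne))

/-- The eigenframe as an element of `GL₂(A)`. [cite: CalegariMazur2008, Def. 2.3] -/
def eigenFrameGL (hπ : Function.Surjective π) {M : Matrix (Fin 2) (Fin 2) A} {δ : A}
    (h10 : π (M 1 0) = 0) (hne : π (M 0 0) ≠ π (M 1 1)) (hδ : π δ = π (M 1 1)) : GL (Fin 2) A :=
  ((Matrix.isUnit_iff_isUnit_det _).2 (isUnit_det_eigenFrame hπ h10 hne hδ)).unit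

/-- The underlying matrix of `eigenFrameGL` is `eigenFrame`. [folklore] -/
@[simp] theorem coe_eigenFrameGL (hπ : Function.Surjective π) {M : Matrix (Fin 2) (Fin 2) A}
    {δ : A} (h10 : π (M 1 0) = 0) (hne : π (M 0 0) ≠ π (M 1 1)) (hδ : π δ = π (M 1 1)) :
    (eigenFrameGL hπ h10 hne hδ : Matrix (Fin 2) (Fin 2) A) = eigenFrame M δ := rfl

/-- In the eigenframe, `M` is diagonal: `C⁻¹ M C = diag(α, δ)`. [cite: CalegariMazur2008, Def. 2.3] -/
theorem eigenFrameGL_inv_mul_mul (hπ : Function.Surjective π) {M : Matrix (Fin 2) (Fin 2) A}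
    {δ : A} (h10 : π (M 1 0) = 0) (hne : π (M 0 0) ≠ π (M 1 1)) (hδ : π δ = π (M 1 1))
    (h : IsCharRoot M δ) :
    ((eigenFrameGL hπ h10 hne hδ)⁻¹ : GL (Fin 2) A).val * M * (eigenFrameGL hπ h10 hne hδ).val =
      Matrix.diagonal ![M 0 0 + M 1 1 - δ, δ] := by
  set C := eigenFrameGL hπ h10 hne hδ with hC
  have hCinv : (C⁻¹).val * C.val = 1 := by
    rw [← Units.val_mul, inv_mul_cancel, Units.val_one]
  have hCval : C.val = eigenFrame M δ := rfl
  rw [Matrix.mul_assoc, hCval, mul_eigenFrame h, ← Matrix.mul_assoc, ← hCval, hCinv, Matrix.one_mul]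

/-- **Uniqueness of the special line** (Calegari–Mazur, Def. 2.3: "if `ρ` is distinguished at
`v` … and `V_A` is indecomposable … there is only one such choice").  Let `M` be residually upper
triangular with distinct diagonal residues, `δ` the Hensel root, `C` the eigenframe.  If
`P ∈ GL₂(A)` is a frame whose first column reduces into the residual special line `k e₁`
(`π P₁₀ = 0`) and spans an `M`-stable line (`(P⁻¹ M P)₁₀ = 0`), then `P e₁ ∈ A · C e₁`, i.e.
`(C⁻¹ P)₁₀ = 0`. [cite: CalegariMazur2008, Def. 2.3] -/
theorem eigenFrameGL_inv_mul_lowerLeft_eq_zero (hπ : Function.Surjective π)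
    {M : Matrix (Fin 2) (Fin 2) A} {δ : A} (h10 : π (M 1 0) = 0) (hne : π (M 0 0) ≠ π (M 1 1))
    (hδ : π δ = π (M 1 1)) (h : IsCharRoot M δ) (P : GL (Fin 2) A) (hP : π (P.val 1 0) = 0)
    (hstab : ((P⁻¹).val * M * P.val) 1 0 = 0) :
    (((eigenFrameGL hπ h10 hne hδ)⁻¹ * P : GL (Fin 2) A).val) 1 0 = 0 := by
  set C := eigenFrameGL hπ h10 hne hδ with hC
  set Q : GL (Fin 2) A := C⁻¹ * P with hQ
  have hQval : Q.val = (C⁻¹).val * P.val := by rw [hQ, Units.val_mul]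
  -- `P = C Q`
  have hPCQ : P.val = C.val * Q.val := by
    rw [hQval, ← Matrix.mul_assoc, ← Units.val_mul, mul_inv_cancel, Units.val_one, Matrix.one_mul]
  -- the first column `y = P e₁` is an eigenvector: `M P e₁ = μ P e₁` with `μ = (P⁻¹ M P)₀₀`
  have hcol : ∀ i, (M * P.val) i 0 = ((P⁻¹).val * M * P.val) 0 0 * P.val i 0 := by
    intro i
    have hMP : M * P.val = P.val * ((P⁻¹).val * M * P.val) := by
      rw [← Matrix.mul_assoc, ← Matrix.mul_assoc, ← Units.val_mul, mul_inv_cancel, Units.val_one,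
        Matrix.one_mul]
    rw [hMP, Matrix.mul_apply, Fin.sum_univ_two, hstab, mul_zero, add_zero, mul_comm]
  -- in the eigenframe coordinates `z = Q e₁`: `diag(α, δ) z = μ z`
  have hdiag : (C⁻¹).val * M * C.val = Matrix.diagonal ![M 0 0 + M 1 1 - δ, δ] :=
    eigenFrameGL_inv_mul_mul hπ h10 hne hδ h
  have hz : ∀ i, (Matrix.diagonal ![M 0 0 + M 1 1 - δ, δ] * Q.val) i 0 =
      ((P⁻¹).val * M * P.val) 0 0 * Q.val i 0 := by
    intro i
    have h1 : Matrix.diagonal ![M 0 0 + M 1 1 - δ, δ] * Q.val = (C⁻¹).val * (M * P.val) := by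
      rw [← hdiag, hQval]
      simp only [Matrix.mul_assoc]
      rw [← Matrix.mul_assoc C.val, ← Units.val_mul, mul_inv_cancel, Units.val_one, Matrix.one_mul]
    rw [h1, hQval]
    simp only [Matrix.mul_apply, Fin.sum_univ_two, hcol]
    ring
  have hz0 : (M 0 0 + M 1 1 - δ) * Q.val 0 0 = ((P⁻¹).val * M * P.val) 0 0 * Q.val 0 0 := by
    have := hz 0
    rwa [Matrix.diagonal_mul] at this
  have hz1 : δ * Q.val 1 0 = ((P⁻¹).val * M * P.val) 0 0 * Q.val 1 0 := by
    have := hz 1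
    rwa [Matrix.diagonal_mul] at this
  -- residually: `π Q₁₀ = 0` (from `P₁₀ = M₁₀ Q₀₀ + (δ - M₀₀) Q₁₀`) and `π Q₀₀ ≠ 0`
  have hQ10 : π (Q.val 1 0) = 0 := by
    have hP10 : P.val 1 0 = M 1 0 * Q.val 0 0 + (δ - M 0 0) * Q.val 1 0 := by
      rw [hPCQ, Matrix.mul_apply, Fin.sum_univ_two]
      rfl
    have := congrArg π hP10
    rw [hP, map_add, map_mul, map_mul, map_sub, h10, hδ, zero_mul, zero_add] at this
    rcases mul_eq_zero.1 this.symm with h0 | h0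
    · exact absurd (sub_eq_zero.1 h0).symm hne
    · exact h0
  have hQ00 : π (Q.val 0 0) ≠ 0 := by
    have hdet : IsUnit (Q.val.det) := Matrix.isUnits_det_units Q
    rw [isUnit_iff_residue_ne_zero hπ, det_fin_two, map_sub, map_mul, map_mul, hQ10, mul_zero,
      sub_zero] at hdet
    exact left_ne_zero_of_mul hdet
  -- hence `μ = α` and `(δ - α) Q₁₀ = 0`, so `Q₁₀ = 0`
  have hμα : ((P⁻¹).val * M * P.val) 0 0 = M 0 0 + M 1 1 - δ := by
    have hu : IsUnit (Q.val 0 0) := (isUnit_iff_residue_ne_zero hπ).2 hQ00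
    exact (hu.mul_right_cancel hz0).symm
  have hunit : IsUnit (δ - (M 0 0 + M 1 1 - δ)) := by
    rw [isUnit_iff_residue_ne_zero hπ]
    simp only [map_sub, map_add, hδ]
    intro h0
    apply hne
    linear_combination (-1 : k) * h0
  have hfin : (δ - (M 0 0 + M 1 1 - δ)) * Q.val 1 0 = 0 := by rw [sub_mul, hz1, hμα, sub_self]
  exact (hunit.mul_right_eq_zero).1 hfin

/-- **Near-ordinarity is detected by the eigenframe.**  With `M`, `δ`, `C` as above and `N` any
family of matrices containing `M`, the following are equivalent: (i) some frame `P ∈ GL₂(A)` with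
`π P₁₀ = 0` makes every `N i` upper triangular; (ii) the eigenframe `C` does.  (This turns the
existential nearly-ordinary condition of [CM, Def. 2.2] into a closed condition once the residual
representation is `v`-distinguished, [CM, Def. 2.3].) [cite: CalegariMazur2008, Def. 2.2–2.3] -/
theorem exists_frame_iff_eigenFrameGL (hπ : Function.Surjective π)
    {M : Matrix (Fin 2) (Fin 2) A} {δ : A} (h10 : π (M 1 0) = 0) (hne : π (M 0 0) ≠ π (M 1 1))
    (hδ : π δ = π (M 1 1)) (h : IsCharRoot M δ) {ι : Type*} (N : ι → Matrix (Fin 2) (Fin 2) A)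
    (hM : ∃ i₀, N i₀ = M) :
    (∃ P : GL (Fin 2) A, π (P.val 1 0) = 0 ∧ ∀ i, ((P⁻¹).val * N i * P.val) 1 0 = 0) ↔
      ∀ i, (((eigenFrameGL hπ h10 hne hδ)⁻¹).val * N i * (eigenFrameGL hπ h10 hne hδ).val) 1 0
        = 0 := by
  set C := eigenFrameGL hπ h10 hne hδ with hC
  constructor
  · rintro ⟨P, hP, hup⟩ i
    obtain ⟨i₀, hi₀⟩ := hM
    set Q : GL (Fin 2) A := C⁻¹ * P with hQ
    have hQ10 : Q.val 1 0 = 0 :=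
      eigenFrameGL_inv_mul_lowerLeft_eq_zero hπ h10 hne hδ h P hP (by simpa [hi₀] using hup i₀)
    have hQi10 : (Q⁻¹).val 1 0 = 0 := inv_lowerLeft_eq_zero hQ10
    have hCPQ : C = P * Q⁻¹ := by rw [hQ, _root_.mul_inv_rev, inv_inv, mul_inv_cancel_left]
    have key : (C⁻¹).val * N i * C.val =
        ((Q⁻¹)⁻¹ : GL (Fin 2) A).val * ((P⁻¹).val * N i * P.val) * (Q⁻¹).val := by
      rw [hCPQ]
      simp only [_root_.mul_inv_rev, inv_inv, Units.val_mul, Matrix.mul_assoc]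
    rw [key, lowerLeft_conj_eq_zero_iff_of_upper hQi10]
    exact hup i
  · intro hup
    refine ⟨C, ?_, hup⟩
    change π (eigenFrame M δ 1 0) = 0
    rw [eigenFrame_apply_10, h10]

end SpecialLine

section FrameLift

variable {A : Type*} [CommRing A] [IsLocalRing A] {k : Type*} [Field k] {π : A →+* k} {n : Type*}
  [Fintype n] [DecidableEq n]

/-- **Frames lift**: an invertible matrix over the residue field lifts to an invertible matrix over
the local ring (lift the entries; the determinant is residually non-zero, hence a unit).
[folklore] -/
theorem exists_generalLinearGroup_map_eq (hπ : Function.Surjective π) (f : GL n k) :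
    ∃ P : GL n A, Matrix.GeneralLinearGroup.map π P = f := by
  classical
  choose g hg using fun i j => hπ (f.val i j)
  have hmap : (Matrix.of g).map π = f.val := by
    ext i j
    simp [hg]
  have hdet : IsUnit (Matrix.of g).det := by
    rw [isUnit_iff_residue_ne_zero hπ, RingHom.map_det, RingHom.mapMatrix_apply, hmap]
    exact (Matrix.isUnits_det_units f).ne_zero
  refine ⟨((Matrix.isUnit_iff_isUnit_det _).2 hdet).unit, ?_⟩
  ext i j
  rw [Matrix.GeneralLinearGroup.map_apply]
  change π (Matrix.of g i j) = f.val i j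
  simp [hg]

end FrameLift

end Deformation

/-! ### Application: near-ordinarity of a lift is read off in the Hensel eigenframe -/

namespace NearlyOrdinaryDatum

open Deformation

variable {F : Type*} [Field F] [NumberField F] {p : ℕ} {𝒪 : Type*} [CommRing 𝒪] {k : Type*}
  [Field k] [Algebra 𝒪 k] (𝒟 : NearlyOrdinaryDatum F p 𝒪 k)
  {A : Type*} [CommRing A] [IsLocalRing A] [Algebra 𝒪 A]

omit [IsLocalRing A] in
/-- **Change of frame.**  If `Fv ∈ GL₂(A)` lifts the residual frame `𝒟.frame v`, then `ρ` is
nearly ordinary at `v` iff `Fv⁻¹ ρ|_{D_v} Fv` admits a frame `P` with `π P₁₀ = 0` making it upper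
triangular (substitute `P ↦ Fv P`). [cite: CalegariMazur2008, Def. 2.2] -/
theorem isNearlyOrdinaryAt_iff_of_frameLift (π : A →ₐ[𝒪] k)
    (ρ : absoluteGaloisGroup F →* GL (Fin 2) A) (v : HeightOneSpectrum (𝓞 F)) (Fv : GL (Fin 2) A)
    (hF : Matrix.GeneralLinearGroup.map (π : A →+* k) Fv = 𝒟.frame v) :
    𝒟.IsNearlyOrdinaryAt π ρ v ↔ ∃ P : GL (Fin 2) A, π (P.val 1 0) = 0 ∧
      ∀ σ, ((P⁻¹).val * (Fv⁻¹ * ρ (absGaloisRestrict F (v.adicCompletion F) σ) * Fv).val *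
        P.val) 1 0 = 0 := by
  constructor
  · rintro ⟨P, hP, hup⟩
    refine ⟨Fv⁻¹ * P, ?_, fun σ => ?_⟩
    · have h1 : Matrix.GeneralLinearGroup.map (π : A →+* k) (Fv⁻¹ * P) =
          (𝒟.frame v)⁻¹ * Matrix.GeneralLinearGroup.map (π : A →+* k) P := by
        rw [map_mul, map_inv, hF]
      have h2 := Matrix.GeneralLinearGroup.map_apply (π : A →+* k) 1 0 (Fv⁻¹ * P)
      rw [h1] at h2
      rw [← hP]
      exact h2.symm
    · have hid : (Fv⁻¹ * P)⁻¹ * (Fv⁻¹ * ρ (absGaloisRestrict F (v.adicCompletion F) σ) * Fv) *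
          (Fv⁻¹ * P) = P⁻¹ * ρ (absGaloisRestrict F (v.adicCompletion F) σ) * P := by
        group
      have := congrArg (fun X : GL (Fin 2) A => X.val 1 0) hid
      simp only [Units.val_mul] at this
      simp only [Units.val_mul]
      rw [this, ← Units.val_mul, ← Units.val_mul]
      exact hup σ
  · rintro ⟨P, hP, hup⟩
    refine ⟨Fv * P, ?_, fun σ => ?_⟩
    · have h1 : (𝒟.frame v)⁻¹ * Matrix.GeneralLinearGroup.map (π : A →+* k) (Fv * P) =
          Matrix.GeneralLinearGroup.map (π : A →+* k) P := by
        rw [map_mul, hF, inv_mul_cancel_left]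
      rw [h1]
      have h2 := Matrix.GeneralLinearGroup.map_apply (π : A →+* k) 1 0 P
      rw [h2]
      exact hP
    · have hid : (Fv * P)⁻¹ * ρ (absGaloisRestrict F (v.adicCompletion F) σ) * (Fv * P) =
          P⁻¹ * (Fv⁻¹ * ρ (absGaloisRestrict F (v.adicCompletion F) σ) * Fv) * P := by
        group
      rw [hid]
      simp only [Units.val_mul]
      have := hup σ
      simpa only [Units.val_mul] using this

omit [IsLocalRing A] in
/-- In the conjugated lift `Fv⁻¹ ρ Fv`, residues of entries are the entries of the residual
representation in the residual frame: `π (Fv⁻¹ ρ(σ) Fv)ᵢⱼ = ((frame v)⁻¹ ρ̄(σ) (frame v))ᵢⱼ`.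
[folklore] -/
theorem residue_frameConj_apply (π : A →ₐ[𝒪] k) {ρ : absoluteGaloisGroup F →* GL (Fin 2) A}
    (hres : (Matrix.GeneralLinearGroup.map (π : A →+* k)).comp ρ = 𝒟.residual)
    {v : HeightOneSpectrum (𝓞 F)} {Fv : GL (Fin 2) A}
    (hF : Matrix.GeneralLinearGroup.map (π : A →+* k) Fv = 𝒟.frame v) (γ : absoluteGaloisGroup F)
    (i j : Fin 2) :
    π ((Fv⁻¹ * ρ γ * Fv).val i j) = ((𝒟.frame v)⁻¹ * 𝒟.residual γ * 𝒟.frame v).val i j := by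
  have hγ : Matrix.GeneralLinearGroup.map (π : A →+* k) (ρ γ) = 𝒟.residual γ :=
    DFunLike.congr_fun hres γ
  have h1 : Matrix.GeneralLinearGroup.map (π : A →+* k) (Fv⁻¹ * ρ γ * Fv) =
      (𝒟.frame v)⁻¹ * 𝒟.residual γ * 𝒟.frame v := by
    rw [map_mul, map_mul, map_inv, hF, hγ]
  have h2 := Matrix.GeneralLinearGroup.map_apply (π : A →+* k) i j (Fv⁻¹ * ρ γ * Fv)
  rw [h1] at h2
  exact h2.symm

/-- **Near-ordinarity in the Hensel eigenframe** (Calegari–Mazur, Def. 2.2–2.3, made effective).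
Let `(A, π)` be a Henselian local `𝒪`-algebra augmented onto `k`, `ρ : Γ_F → GL₂(A)` a lift of
`ρ̄` (`GL₂(π) ∘ ρ = ρ̄`), `v` a place at which `ρ̄` is upper triangular in the frame `frame v`
with DISTINCT diagonal characters, witnessed at `σ₀ ∈ Γ_{F_v}`, `Fv ∈ GL₂(A)` a lift of `frame v`,
`δ ∈ A` the Hensel root of the characteristic polynomial of `M = Fv⁻¹ ρ(σ₀) Fv` lifting the lower
residual eigenvalue, and `C` the eigenframe of `(M, δ)`.  Then `ρ` is nearly ordinary at `v` (with
the prescribed residual special line) if and only if `ρ|_{D_v}` is upper triangular in the single,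
canonical frame `Fv · C`: the special line, when it exists, is the `α`-eigenline of `ρ(σ₀)`.  (The
residual hypotheses `h10`, `hne` on `M` are the frame condition `𝒟.frame_spec` and
distinguishedness `𝒟.IsDistinguishedAt v` at `σ₀`, transported by `residue_frameConj_apply`.)
[cite: CalegariMazur2008, Def. 2.2–2.3] -/
theorem isNearlyOrdinaryAt_iff_eigenFrameGL (π : A →ₐ[𝒪] k) (hπ : Function.Surjective π)
    (ρ : absoluteGaloisGroup F →* GL (Fin 2) A) (v : HeightOneSpectrum (𝓞 F)) {Fv : GL (Fin 2) A}
    (hF : Matrix.GeneralLinearGroup.map (π : A →+* k) Fv = 𝒟.frame v)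
    (σ₀ : absoluteGaloisGroup (v.adicCompletion F))
    (h10 : π ((Fv⁻¹ * ρ (absGaloisRestrict F (v.adicCompletion F) σ₀) * Fv).val 1 0) = 0)
    (hne : π ((Fv⁻¹ * ρ (absGaloisRestrict F (v.adicCompletion F) σ₀) * Fv).val 0 0) ≠
        π ((Fv⁻¹ * ρ (absGaloisRestrict F (v.adicCompletion F) σ₀) * Fv).val 1 1))
    {δ : A} (hδ : π δ = π ((Fv⁻¹ * ρ (absGaloisRestrict F (v.adicCompletion F) σ₀) * Fv).val 1 1))
    (hroot : IsCharRoot (Fv⁻¹ * ρ (absGaloisRestrict F (v.adicCompletion F) σ₀) * Fv).val δ) :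
    𝒟.IsNearlyOrdinaryAt π ρ v ↔
      ∀ σ, ((Fv * eigenFrameGL (π := (π : A →+* k)) hπ h10 hne hδ)⁻¹ *
          ρ (absGaloisRestrict F (v.adicCompletion F) σ) *
          (Fv * eigenFrameGL (π := (π : A →+* k)) hπ h10 hne hδ)).val 1 0 = 0 := by
  refine (𝒟.isNearlyOrdinaryAt_iff_of_frameLift π ρ v Fv hF).trans ?_
  refine (exists_frame_iff_eigenFrameGL (π := (π : A →+* k)) hπ h10 hne hδ hroot
      (fun σ => (Fv⁻¹ * ρ (absGaloisRestrict F (v.adicCompletion F) σ) * Fv).val) ⟨σ₀, rfl⟩).trans ?_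
  refine forall_congr' fun σ => ?_
  have hid : ((Fv * eigenFrameGL (π := (π : A →+* k)) hπ h10 hne hδ)⁻¹ *
        ρ (absGaloisRestrict F (v.adicCompletion F) σ) *
        (Fv * eigenFrameGL (π := (π : A →+* k)) hπ h10 hne hδ)) =
      (eigenFrameGL (π := (π : A →+* k)) hπ h10 hne hδ)⁻¹ *
        (Fv⁻¹ * ρ (absGaloisRestrict F (v.adicCompletion F) σ) * Fv) *
        eigenFrameGL (π := (π : A →+* k)) hπ h10 hne hδ := by
    group
  rw [hid]
  simp only [Units.val_mul]

end NearlyOrdinaryDatum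

end Literature.NumberTheory.GaloisRepresentations
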